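import Literature.MathematicalPhysics.QuantumFieldTheory.Balaban1983to89.B11Prop6Concrete
import Literature.MathematicalPhysics.QuantumFieldTheory.Balaban1983to89.B9Eq33CovDerivVector
import Literature.MathematicalPhysics.QuantumFieldTheory.Balaban1983to89.T3PrintedRegularMinimiser
import HarnessLib

/-!
# `UnitScaleTiltProp7SectET3Transport` — THE TRANSPORT HELPERS BETWEEN THE T³ FAMILY'S LATTICE LETTERS AND THE [B9]∕[B11] PERIODIC-LATTICE CARRIERS
# OF THE SECT. E DATUM (route `UnitScaleTilt`, crux K1 «MinimiserStabilityRegPr» stmt-QuantumFields-19200, stub `stub_existenceMinimalOrbit`, route (α),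
# (S2) of OWNER RULING g25-№1; split to width seat ym-ust-20520-w5 by OWNER g25 2026-08-28T01:52:27Z; consumed by ★w4-19200's T³ `SectEDatum` instance file)

Cell `ym3-torus` (HUMAN RULING D-0037, YM ladder rung R3).  The (α)-core of EX reads [Balaban1985Variational] Sect. E through `B11Prop6Concrete.SectEDatum d Pd 𝔸 L η β …`,
typed over the periodic lattice `B9SectCLatticeCarrier.Bond d Pd = B4Sect5Torus.TSite d Pd × Fin d`, `TSite d Pd = Π_i Fin (Pd i)`, with a fibre algebra `𝔸` and
backgrounds `Bond d Pd → 𝔸ˣ`; the route's objects live on `Setup.Site (F.P K) 0 = Fin 3 → ZMod (2L^{m+K})`, `Setup.PBond (F.P K) 0`, with `SU(2)`-valued gauge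
fields.  This file supplies the four by-name transports the census `N06-FIT-CENSUS-H1-w5g0.md` §2 (t1)–(t3), (N2) located:
* §1 (t1) `periodsT3 F K := fun _ ↦ (F.P K).sitesPerDir 0` (an `abbrev`); **`siteEquiv F K : Site (F.P K) 0 ≃ TSite 3 (periodsT3 F K)`** — THE SITE CHART OF RECORD
  (coordinatewise `ZMod.finEquiv`; `(F.P K).d = 3` is definitional) with its SHIFT-COMPATIBILITY **`siteEquiv_shift : e (x.shift μ) = B9SectCLatticeCarrier.shift μ (e x)`**
  (twin `siteEquiv_shiftEquiv` against `B9Eq33CovDerivVector.shiftEquiv μ`, inverse form `siteEquiv_symm_shift`); along an ARBITRARY chart `e` (section `AnyChart`, what the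
  (α)-objects file types against): **`bondEquivOf e : PBond P j ≃ Bond P.d Pd`** (`⟨x, μ⟩ ↦ (e x, μ)`), **`cfgEquivOf e G`** (`U ↦ fun b ↦ U ⟨e⁻¹ b.1, b.2⟩`, `cfgEquivOf_eq`)
  with the SUP-NORM IDENTITIES `norm_cfgEquivOf`∕`norm_lambda_pullback`∕`forall_norm_cfgEquivOf_iff`; and their specialisations to the chart of record `bondEquiv F K`,
  `cfgEquiv F K G`, `btgt_bondEquiv` (end points match), `norm_cfgEquiv`;
* §2 (t2) **`isUnitaryBg_unitsField_toUField_comp`** (chart-free: any re-indexed `SU(N)` configuration read through `B10Eq27TorusAxialLog.toUField`∕`unitsField` is a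
  `B11Prop6Concrete.IsUnitaryBg` background — the `bg_unitary` field), `isUnitaryBg_lambda_pullback` (abstract chart), and for the T³ family **`bgOfCfg F K U : Bond 3
  (periodsT3 F K) → (M₂(ℂ))ˣ`** with `bgOfCfg_eq` (`= fun b ↦ unitsField (toUField U) ⟨e⁻¹ b.1, b.2⟩`, `rfl`), `val_bgOfCfg`, **`isUnitaryBg_bgOfCfg`**;
* §3 (N2) **`piIsoNegSize0 V L η levB : (β → V) ≃ₗᵢ[ℂ] NegSize L η levB 0 V`** — the identity as a LINEAR ISOMETRY onto the weight-`(L^jη)⁰ = 1` size `|·|₍₀₎` (the domain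
  of `B11Eq103H1Complex.H1LatticeCLM` vs the `(β → 𝔸)` domain of `SectEDatum.H₁`), `norm_negSize_zero`, `opNorm_comp_piIsoNegSize0`;
* §4 (t3) **`levWeight_const_eq_one`**: with constant level maps `lev ≡ k` (the pure small-field problem: every `Ω_j` the whole torus) and `η := L^{−k}`, every (115)-weight
  `(L^{j(x)}η)^n` is `1`; `norm_negSize_const_eq` (then `|·|₍₋ₙ₎` is the plain sup norm).
HONEST FRAMING.  Bookkeeping (equivalences, re-indexing, one isometry, one power identity); nothing of [Balaban1985Variational] ∕ [Balaban1985BackgroundPropagators] is asserted;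
no stub∕crux∕count moves (`--supports stmt-QuantumFields-19200 --as helper`); YM₃ on T³ is ladder rung R3 — not d = 4, not a mass gap, not Clay.

References: T. Bałaban, CMP 102 (1985) 277–309 [Balaban1985Variational] ((115) p.294, p.286); CMP 102 (1985) 255–275 [Balaban1985UV3] ((1)–(3) p.256); CMP 98 (1985) 17–51
[Balaban1985Averaging] ((19) p.21).
-/

set_option autoImplicit false

noncomputable section

open scoped Matrix.Norms.L2Operator
open Literature.MathematicalPhysics.QuantumFieldTheory.Balaban1983to89
open Literature.MathematicalPhysics.QuantumFieldTheory.Balaban1983to89.T3ContinuumYM3Torus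
open Literature.MathematicalPhysics.QuantumFieldTheory.Balaban1983to89.B10Eq27TorusAxialLog (toUField unitsField val_unitsField)
open B9SectCLatticeCarrier (Bond)
open B4Sect5Torus (TSite)
open B11Eq115Space (NegSize NegSup levWeight levWeight_apply)

namespace Summit.QuantumFields.YangMills.Theorems.Prop7SectET3Transport

/-! ## §1 (t1) Sites, bonds, configurations -/

/-- **THE PERIODS OF THE FINEST LATTICE OF RUN `K`** of a T³ member as [B9] periods `Pd : Fin 3 → ℕ` (all directions `2L^{m+K}`).
[cite: Balaban1985UV3, (1)-(3) p.256] -/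
abbrev periodsT3 (F : T3Family) (K : ℕ) : Fin 3 → ℕ := fun _ => (F.P K).sitesPerDir 0

/-- Unfolding the periods. [cite: Balaban1985UV3, (1)-(3) p.256] -/
theorem periodsT3_apply (F : T3Family) (K : ℕ) (i : Fin 3) : periodsT3 F K i = (F.P K).sitesPerDir 0 := rfl

/-- **SITES — THE CHART OF RECORD**: the route's `Site (F.P K) 0 = Fin 3 → ZMod (2L^{m+K})` is the [B9] torus `TSite 3 (periodsT3 F K) = Π_i Fin (2L^{m+K})`,
coordinatewise by `ZMod.finEquiv` (`(F.P K).d = 3` definitionally). [folklore] -/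
def siteEquiv (F : T3Family) (K : ℕ) : Site (F.P K) 0 ≃ TSite 3 (periodsT3 F K) where
  toFun x i := (ZMod.finEquiv ((F.P K).sitesPerDir 0)).symm (x i)
  invFun y i := ZMod.finEquiv ((F.P K).sitesPerDir 0) (y i)
  left_inv x := funext fun i => RingEquiv.apply_symm_apply _ (x i)
  right_inv y := funext fun i => RingEquiv.symm_apply_apply _ (y i)

/-- The chart reads coordinate `i` through `(ZMod.finEquiv _).symm`. [folklore] -/
theorem siteEquiv_apply (F : T3Family) (K : ℕ) (x : Site (F.P K) 0) (i : Fin 3) :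
    siteEquiv F K x i = (ZMod.finEquiv ((F.P K).sitesPerDir 0)).symm (x i) := rfl

/-- The inverse chart reads coordinate `i` through `ZMod.finEquiv _`. [folklore] -/
theorem siteEquiv_symm_apply (F : T3Family) (K : ℕ) (y : TSite 3 (periodsT3 F K)) (i : Fin 3) :
    (siteEquiv F K).symm y i = ZMod.finEquiv ((F.P K).sitesPerDir 0) (y i) := rfl

/-- **SHIFT-COMPATIBILITY OF THE CHART**: `e (x + e_μ) = (e x) + e_μ` — the route's `Site.shift` is carried to the [B9] unit step `B9SectCLatticeCarrier.shift`
(both are `+1` modulo the period in coordinate `μ`, identity elsewhere). [folklore] -/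
theorem siteEquiv_shift (F : T3Family) (K : ℕ) (x : Site (F.P K) 0) (μ : Fin 3) :
    siteEquiv F K (x.shift μ) = B9SectCLatticeCarrier.shift μ (siteEquiv F K x) := by
  funext i
  by_cases h : i = μ
  · subst h
    apply Fin.ext
    rw [B9SectCLatticeCarrier.shift_apply_val, siteEquiv_apply, siteEquiv_apply,
      show x.shift i i = x i + 1 from Function.update_self _ _ _, map_add, map_one, Fin.val_add, Fin.val_one', Nat.add_mod_mod]
  · rw [B9SectCLatticeCarrier.shift_apply_ne h, siteEquiv_apply, siteEquiv_apply, show x.shift μ i = x i from Function.update_of_ne h _ _]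

/-- … the same against the bundled step `B9Eq33CovDerivVector.shiftEquiv μ` (whose forward map is `shift μ`). [folklore] -/
theorem siteEquiv_shiftEquiv (F : T3Family) (K : ℕ) (x : Site (F.P K) 0) (μ : Fin 3) :
    siteEquiv F K (x.shift μ) = B9Eq33CovDerivVector.shiftEquiv μ (siteEquiv F K x) :=
  siteEquiv_shift F K x μ

/-- … and the inverse chart: `e⁻¹ (y + e_μ) = (e⁻¹ y) + e_μ`. [folklore] -/
theorem siteEquiv_symm_shift (F : T3Family) (K : ℕ) (y : TSite 3 (periodsT3 F K)) (μ : Fin 3) :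
    (siteEquiv F K).symm (B9SectCLatticeCarrier.shift μ y) = ((siteEquiv F K).symm y).shift μ := by
  apply (siteEquiv F K).injective
  rw [Equiv.apply_symm_apply, siteEquiv_shift, Equiv.apply_symm_apply]

/-! ### Bonds and configurations along an ARBITRARY site chart `e` (the (α)-objects file types against an abstract `e`; `bondEquiv F K` below is the
case `e := siteEquiv F K`) -/

section AnyChart

variable {P : Params} {j : ℕ} {Pd : Fin P.d → ℕ} (e : Site P j ≃ TSite P.d Pd)

/-- **BONDS ALONG A SITE CHART**: `⟨x, μ⟩ ↦ (e x, μ)`, `PBond P j ≃ Bond P.d Pd = TSite × Fin d`. [folklore] -/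
def bondEquivOf : PBond P j ≃ Bond P.d Pd where
  toFun b := (e b.src, b.dir)
  invFun p := ⟨e.symm p.1, p.2⟩
  left_inv b := by simp
  right_inv p := by simp

/-- The transported bond is `(e x, μ)`. [folklore] -/
theorem bondEquivOf_apply (b : PBond P j) : bondEquivOf e b = (e b.src, b.dir) := rfl

/-- The pulled-back bond is `⟨e⁻¹ y, μ⟩`. [folklore] -/
theorem bondEquivOf_symm_apply (p : Bond P.d Pd) : (bondEquivOf e).symm p = ⟨e.symm p.1, p.2⟩ := rfl

/-- **CONFIGURATIONS ALONG A SITE CHART** (any fibre `G`): `(PBond P j → G) ≃ (Bond P.d Pd → G)` by re-indexing (`GaugeField P j G` is the left type by `def`).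
[folklore] -/
def cfgEquivOf (G : Type*) : (PBond P j → G) ≃ (Bond P.d Pd → G) :=
  Equiv.arrowCongr (bondEquivOf e) (Equiv.refl G)

/-- The transported configuration is the lambda `fun b ↦ U ⟨e⁻¹ b.1, b.2⟩`. [folklore] -/
theorem cfgEquivOf_eq {G : Type*} (U : PBond P j → G) : cfgEquivOf e G U = fun b => U ⟨e.symm b.1, b.2⟩ := rfl

/-- … read at one bond. [folklore] -/
theorem cfgEquivOf_apply {G : Type*} (U : PBond P j → G) (p : Bond P.d Pd) : cfgEquivOf e G U p = U ((bondEquivOf e).symm p) := rfl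

/-- The inverse transport reads the [B9]-indexed configuration at the transported bond. [folklore] -/
theorem cfgEquivOf_symm_apply {G : Type*} (W : Bond P.d Pd → G) (b : PBond P j) : (cfgEquivOf e G).symm W b = W (bondEquivOf e b) := rfl

/-- Re-indexing along an equivalence preserves the sup norm. [folklore] -/
theorem norm_comp_equiv {α γ : Type*} [Fintype α] [Fintype γ] {V : Type*} [SeminormedAddCommGroup V] (g : α ≃ γ) (f : γ → V) :
    ‖(fun a => f (g a))‖ = ‖f‖ := by
  refine le_antisymm ((pi_norm_le_iff_of_nonneg (norm_nonneg f)).2 fun a => norm_le_pi_norm f (g a))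
    ((pi_norm_le_iff_of_nonneg (norm_nonneg _)).2 fun c => ?_)
  have h := norm_le_pi_norm (fun a => f (g a)) (g.symm c)
  simpa only [Equiv.apply_symm_apply] using h

/-- **THE SUP-NORM IDENTITY OF THE CONFIGURATION TRANSPORT**: `‖cfgEquivOf e V U‖ = ‖U‖` for every seminormed fibre (so every `‖·‖ ≤ …` row transports verbatim).
[folklore] -/
theorem norm_cfgEquivOf {V : Type*} [SeminormedAddCommGroup V] (U : PBond P j → V) : ‖cfgEquivOf e V U‖ = ‖U‖ :=
  norm_comp_equiv (bondEquivOf e).symm U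

/-- … and `‖(cfgEquivOf e V).symm W‖ = ‖W‖`. [folklore] -/
theorem norm_cfgEquivOf_symm {V : Type*} [SeminormedAddCommGroup V] (W : Bond P.d Pd → V) : ‖(cfgEquivOf e V).symm W‖ = ‖W‖ :=
  norm_comp_equiv (bondEquivOf e) W

/-- The lambda form of the sup-norm identity: `‖fun b ↦ U ⟨e⁻¹ b.1, b.2⟩‖ = ‖U‖`. [folklore] -/
theorem norm_lambda_pullback {V : Type*} [SeminormedAddCommGroup V] (U : PBond P j → V) :
    ‖(fun b : Bond P.d Pd => U ⟨e.symm b.1, b.2⟩)‖ = ‖U‖ :=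
  norm_cfgEquivOf e U

/-- Bondwise bounds transport along `cfgEquivOf` (both directions are re-indexings). [folklore] -/
theorem forall_norm_cfgEquivOf_iff {V : Type*} [SeminormedAddCommGroup V] (U : PBond P j → V) (r : ℝ) :
    (∀ p, ‖cfgEquivOf e V U p‖ ≤ r) ↔ ∀ b, ‖U b‖ ≤ r :=
  ⟨fun h b => by simpa only [cfgEquivOf_apply, Equiv.symm_apply_apply] using h (bondEquivOf e b), fun h p => h _⟩

end AnyChart

/-! ### The T³ family's bonds and configurations along the chart of record -/

/-- **BONDS**: `PBond (F.P K) 0 ≃ Bond 3 (periodsT3 F K)`, `⟨x, μ⟩ ↦ (siteEquiv F K x, μ)`. [folklore] -/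
def bondEquiv (F : T3Family) (K : ℕ) : PBond (F.P K) 0 ≃ Bond 3 (periodsT3 F K) := bondEquivOf (siteEquiv F K)

/-- The transported bond is `(e x, μ)`. [folklore] -/
theorem bondEquiv_apply (F : T3Family) (K : ℕ) (b : PBond (F.P K) 0) : bondEquiv F K b = (siteEquiv F K b.src, b.dir) := rfl

/-- The source of the transported bond is the transported source. [folklore] -/
theorem bondEquiv_apply_fst (F : T3Family) (K : ℕ) (b : PBond (F.P K) 0) : (bondEquiv F K b).1 = siteEquiv F K b.src := rfl

/-- The direction of the transported bond is the direction. [folklore] -/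
theorem bondEquiv_apply_snd (F : T3Family) (K : ℕ) (b : PBond (F.P K) 0) : (bondEquiv F K b).2 = b.dir := rfl

/-- The pulled-back bond is `⟨e⁻¹ y, μ⟩`. [folklore] -/
theorem bondEquiv_symm_apply (F : T3Family) (K : ℕ) (p : Bond 3 (periodsT3 F K)) : (bondEquiv F K).symm p = ⟨(siteEquiv F K).symm p.1, p.2⟩ := rfl

/-- **END POINTS MATCH**: the [B9] target `btgt (e x, μ) = e x + e_μ` of the transported bond is the chart image of the route's target `b.tgt = x + e_μ`
(shift-compatibility). [folklore] -/
theorem btgt_bondEquiv (F : T3Family) (K : ℕ) (b : PBond (F.P K) 0) : B9SectCLatticeCarrier.btgt (bondEquiv F K b) = siteEquiv F K b.tgt :=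
  (siteEquiv_shift F K b.src b.dir).symm

/-- … and the [B9] base point is the chart image of the source. [folklore] -/
theorem bpos_bondEquiv (F : T3Family) (K : ℕ) (b : PBond (F.P K) 0) : B9SectCLatticeCarrier.bpos (bondEquiv F K b) = siteEquiv F K b.src := rfl

/-- **CONFIGURATIONS** (any fibre `G`): `(PBond (F.P K) 0 → G) ≃ (Bond 3 (periodsT3 F K) → G)` along the chart of record. [folklore] -/
def cfgEquiv (F : T3Family) (K : ℕ) (G : Type*) : (PBond (F.P K) 0 → G) ≃ (Bond 3 (periodsT3 F K) → G) := cfgEquivOf (siteEquiv F K) G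

/-- The transported configuration is the lambda `fun b ↦ U ⟨e⁻¹ b.1, b.2⟩` at `e := siteEquiv F K`. [folklore] -/
theorem cfgEquiv_eq (F : T3Family) (K : ℕ) {G : Type*} (U : PBond (F.P K) 0 → G) :
    cfgEquiv F K G U = fun b => U ⟨(siteEquiv F K).symm b.1, b.2⟩ := rfl

/-- The transported configuration reads the original at the pulled-back bond. [folklore] -/
theorem cfgEquiv_apply (F : T3Family) (K : ℕ) {G : Type*} (U : PBond (F.P K) 0 → G) (p : Bond 3 (periodsT3 F K)) :
    cfgEquiv F K G U p = U ((bondEquiv F K).symm p) := rfl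

/-- … and the inverse transport reads the [B9]-indexed configuration at the transported bond. [folklore] -/
theorem cfgEquiv_symm_apply (F : T3Family) (K : ℕ) {G : Type*} (W : Bond 3 (periodsT3 F K) → G) (b : PBond (F.P K) 0) :
    (cfgEquiv F K G).symm W b = W (bondEquiv F K b) := rfl

/-- `‖cfgEquiv F K V U‖ = ‖U‖`. [folklore] -/
theorem norm_cfgEquiv (F : T3Family) (K : ℕ) {V : Type*} [SeminormedAddCommGroup V] (U : PBond (F.P K) 0 → V) : ‖cfgEquiv F K V U‖ = ‖U‖ :=
  norm_cfgEquivOf (siteEquiv F K) U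

/-- `‖(cfgEquiv F K V).symm W‖ = ‖W‖`. [folklore] -/
theorem norm_cfgEquiv_symm (F : T3Family) (K : ℕ) {V : Type*} [SeminormedAddCommGroup V] (W : Bond 3 (periodsT3 F K) → V) :
    ‖(cfgEquiv F K V).symm W‖ = ‖W‖ :=
  norm_cfgEquivOf_symm (siteEquiv F K) W

/-- Bondwise bounds transport along `cfgEquiv`. [folklore] -/
theorem forall_norm_cfgEquiv_iff (F : T3Family) (K : ℕ) {V : Type*} [SeminormedAddCommGroup V] (U : PBond (F.P K) 0 → V) (r : ℝ) :
    (∀ p, ‖cfgEquiv F K V U p‖ ≤ r) ↔ ∀ b, ‖U b‖ ≤ r :=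
  forall_norm_cfgEquivOf_iff (siteEquiv F K) U r

/-! ## §2 (t2) The fibre: an `SU(N)` gauge field as a [B11] background `Bond d Pd → (M_N(ℂ))ˣ` -/

/-- **ANY RE-INDEXED `SU(N)` CONFIGURATION READ IN `(M_N(ℂ))ˣ` IS A `G`-VALUED BACKGROUND, `G ⊂ U(N)`**: `U⁻¹ = U*` bondwise — the `bg_unitary` field
(`B11Prop6Concrete.IsUnitaryBg`) for the lambda `fun b ↦ unitsField (toUField U₀) (g b)` along ANY bond map `g` (chart-free). [cite: Balaban1985Variational, p.277] -/
theorem isUnitaryBg_unitsField_toUField_comp {d : ℕ} {Pd : Fin d → ℕ} {N : ℕ} {P : Params} {j : ℕ}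
    (U : GaugeField P j (Matrix.specialUnitaryGroup (Fin N) ℂ)) (g : Bond d Pd → PBond P j) :
    B11Prop6Concrete.IsUnitaryBg (fun b => unitsField (toUField U) (g b)) := by
  intro b
  show (((Unitary.toUnits (toUField U (g b)))⁻¹ : (Matrix (Fin N) (Fin N) ℂ)ˣ) : Matrix (Fin N) (Fin N) ℂ) =
    star ((Unitary.toUnits (toUField U (g b)) : (Matrix (Fin N) (Fin N) ℂ)ˣ) : Matrix (Fin N) (Fin N) ℂ)
  rw [Unitary.val_inv_toUnits_apply, Unitary.val_toUnits_apply, ← Unitary.star_eq_inv, Unitary.coe_star]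

/-- The abstract-chart form: `fun b ↦ unitsField (toUField U₀) ⟨e⁻¹ b.1, b.2⟩` is a `G`-valued background. [cite: Balaban1985Variational, p.277] -/
theorem isUnitaryBg_lambda_pullback {P : Params} {j : ℕ} {Pd : Fin P.d → ℕ} {N : ℕ} (e : Site P j ≃ TSite P.d Pd)
    (U : GaugeField P j (Matrix.specialUnitaryGroup (Fin N) ℂ)) :
    B11Prop6Concrete.IsUnitaryBg (fun b : Bond P.d Pd => unitsField (toUField U) ⟨e.symm b.1, b.2⟩) :=
  isUnitaryBg_unitsField_toUField_comp U fun b => ⟨e.symm b.1, b.2⟩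

/-- **THE [B11] BACKGROUND OF AN `SU(2)` CONFIGURATION OF RUN `K`** of a T³ member: `SU(2) ≤ U(2) → (M₂(ℂ))ˣ` (`toUField`, `unitsField`) re-indexed along the
chart of record — the `bg` field of a T³ `SectEDatum` instance. [cite: Balaban1985Averaging, (19) p.21] -/
def bgOfCfg (F : T3Family) (K : ℕ) (U : GaugeField (F.P K) 0 (Matrix.specialUnitaryGroup (Fin 2) ℂ)) :
    Bond 3 (periodsT3 F K) → (Matrix (Fin 2) (Fin 2) ℂ)ˣ :=
  cfgEquiv F K _ (unitsField (toUField U))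

/-- **THE BACKGROUND AS A LAMBDA** (the form the (α)-objects file `…Prop7SectET3Objects` types against, at `e := siteEquiv F K`):
`bgOfCfg F K U₀ = fun b ↦ unitsField (toUField U₀) ⟨e⁻¹ b.1, b.2⟩`. [cite: Balaban1985Averaging, (19) p.21] -/
theorem bgOfCfg_eq (F : T3Family) (K : ℕ) (U : GaugeField (F.P K) 0 (Matrix.specialUnitaryGroup (Fin 2) ℂ)) :
    bgOfCfg F K U = fun b => unitsField (toUField U) ⟨(siteEquiv F K).symm b.1, b.2⟩ := rfl

/-- The background's bond matrix is the configuration's matrix at the pulled-back bond. [cite: Balaban1985Averaging, (19) p.21] -/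
theorem val_bgOfCfg (F : T3Family) (K : ℕ) (U : GaugeField (F.P K) 0 (Matrix.specialUnitaryGroup (Fin 2) ℂ)) (p : Bond 3 (periodsT3 F K)) :
    ((bgOfCfg F K U p : (Matrix (Fin 2) (Fin 2) ℂ)ˣ) : Matrix (Fin 2) (Fin 2) ℂ) =
      ((U ((bondEquiv F K).symm p) : Matrix.specialUnitaryGroup (Fin 2) ℂ) : Matrix (Fin 2) (Fin 2) ℂ) := rfl

/-- **THE T³ BACKGROUND IS `G`-VALUED**: `B11Prop6Concrete.IsUnitaryBg (bgOfCfg F K U₀)`. [cite: Balaban1985Variational, p.277] -/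
theorem isUnitaryBg_bgOfCfg (F : T3Family) (K : ℕ) (U : GaugeField (F.P K) 0 (Matrix.specialUnitaryGroup (Fin 2) ℂ)) :
    B11Prop6Concrete.IsUnitaryBg (bgOfCfg F K U) :=
  isUnitaryBg_unitsField_toUField_comp U (bondEquiv F K).symm

/-! ## §3 (N2) The `H₁`-slot bridge: `(β → V)` is the weight-one size `|·|₍₀₎` -/

/-- The weight `(L^{j}η)⁰` is `1`. [cite: Balaban1985Variational, (115) p.294] -/
theorem levWeight_zero {β : Type*} (L η : ℝ) (levB : β → ℕ) (x : β) : levWeight L η levB 0 x = 1 := by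
  rw [levWeight_apply, pow_zero]

section Bridge

variable {β : Type*} [Fintype β] (V : Type*) [NormedAddCommGroup V] [NormedSpace ℂ V] (L η : ℝ) [Fact (0 < L)] [Fact (0 < η)] (levB : β → ℕ)

omit [NormedSpace ℂ V] in
/-- **THE SIZE `|·|₍₀₎` IS THE SUP NORM**: for `f : NegSize L η levB 0 V`, `‖f‖ = ‖NegSup.equiv _ V f‖`. [cite: Balaban1985Variational, (115) p.294, p.286] -/
theorem norm_negSize_zero (f : NegSize L η levB 0 V) : ‖f‖ = ‖NegSup.equiv (levWeight L η levB 0) V f‖ := by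
  refine le_antisymm ?_ ?_
  · exact (NegSup.norm_le_iff (norm_nonneg _)).2 fun i => by
      rw [levWeight_zero, one_mul]; exact norm_le_pi_norm _ i
  · refine (pi_norm_le_iff_of_nonneg (norm_nonneg f)).2 fun i => ?_
    have h := NegSup.weight_mul_norm_apply_le f i
    rwa [levWeight_zero, one_mul] at h

/-- **THE `H₁`-SLOT BRIDGE** (`piIsoNegSize0 V L η levB`): the identity `(β → V) → NegSize L η levB 0 V` as a LINEAR ISOMETRY EQUIVALENCE (norm-preserving, hence a
`→L[ℂ]` both ways) — the domain of `B11Eq103H1Complex.H1LatticeCLM` against the `(β → 𝔸)` domain of `B11Prop6Concrete.SectEDatum.H₁`.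
[cite: Balaban1985Variational, (103) p.293, (115) p.294] -/
def piIsoNegSize0 : (β → V) ≃ₗᵢ[ℂ] NegSize L η levB 0 V where
  toFun f := (NegSup.equiv (levWeight L η levB 0) V).symm f
  map_add' _ _ := rfl
  map_smul' _ _ := rfl
  invFun := NegSup.equiv (levWeight L η levB 0) V
  left_inv _ := rfl
  right_inv _ := rfl
  norm_map' f := by
    rw [norm_negSize_zero]
    rfl

/-- The bridge is the identity on the underlying functions. [folklore] -/
theorem piIsoNegSize0_apply (f : β → V) (i : β) : NegSup.equiv _ V (piIsoNegSize0 V L η levB f) i = f i := rfl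

/-- … and so is its inverse. [folklore] -/
theorem piIsoNegSize0_symm_apply (g : NegSize L η levB 0 V) (i : β) : (piIsoNegSize0 V L η levB).symm g i = NegSup.equiv _ V g i := rfl

/-- An operator on `|·|₍₀₎` precomposed with the bridge keeps its operator norm (isometric domain change). [folklore] -/
theorem opNorm_comp_piIsoNegSize0 {W : Type*} [NormedAddCommGroup W] [NormedSpace ℂ W] (T : NegSize L η levB 0 V →L[ℂ] W) :
    ‖T.comp (piIsoNegSize0 V L η levB).toContinuousLinearEquiv.toContinuousLinearMap‖ = ‖T‖ :=
  ContinuousLinearMap.opNorm_comp_linearIsometryEquiv T (piIsoNegSize0 V L η levB)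

end Bridge

/-! ## §4 (t3) Constant level maps: the pure small-field weights are one -/

/-- **WITH `lev ≡ k` AND `η = L^{−k}` EVERY (115)-WEIGHT IS ONE**: `(L^k·L^{−k})^n = 1` (the pure small-field problem of R3: every `Ω_j` is the whole torus, so the
level of every point is the top level `k = K − n`, and the top lattice has unit spacing). [cite: Balaban1985Variational, (115) p.294, (2) p.278] -/
theorem levWeight_const_eq_one {ι : Type*} {L : ℝ} (hL : L ≠ 0) (k n : ℕ) (x : ι) : levWeight L ((L⁻¹) ^ k) (fun _ => k) n x = 1 := by
  rw [levWeight_apply, ← mul_pow, mul_inv_cancel₀ hL, one_pow, one_pow]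

/-- Hence with constant levels and `η = L^{−k}` the size `|·|₍₋ₙ₎` is the plain sup norm. [cite: Balaban1985Variational, (115) p.294, p.286] -/
theorem norm_negSize_const_eq {ι : Type*} [Fintype ι] {V : Type*} [NormedAddCommGroup V] {L : ℝ} [Fact (0 < L)] (k n : ℕ)
    [Fact (0 < (L⁻¹) ^ k)] (f : NegSize L ((L⁻¹) ^ k) (fun _ : ι => k) n V) :
    ‖f‖ = ‖NegSup.equiv (levWeight L ((L⁻¹) ^ k) (fun _ : ι => k) n) V f‖ := by
  have hL : L ≠ 0 := (Fact.out : 0 < L).ne'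
  refine le_antisymm ?_ ?_
  · exact (NegSup.norm_le_iff (norm_nonneg _)).2 fun i => by
      rw [levWeight_const_eq_one hL, one_mul]; exact norm_le_pi_norm _ i
  · refine (pi_norm_le_iff_of_nonneg (norm_nonneg f)).2 fun i => ?_
    have h := NegSup.weight_mul_norm_apply_le f i
    rwa [levWeight_const_eq_one hL, one_mul] at h

end Summit.QuantumFields.YangMills.Theorems.Prop7SectET3Transport

end
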